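import Mathlib
import Literature.MathematicalPhysics.StatisticalMechanics.Crystallization

/-!
# Crux `ExactCertificate` (stmt-AtomisticToContinuum-11959), line `closure-makes-nogap-exact`,
# Transfer skeleton VI (`UniquePeriodicMinimiser1D`): stub `stub_badOfBadSite1D`

Support file for the crux `ThreeConeCertificate.ExactCertificate`, d = 1 transfer skeleton VI
(`Cruxes.ExactCertificate.Transfer1D.UniquePeriodicMinimiser1D`).  This file proves the
registered stub `stub_badOfBadSite1D`: LOCALITY AND LATTICE COVARIANCE of the two-way
`(R, ε)`-matching predicate, in contrapositive form.

If a site `q₀` of a periodic configuration `Q` of the line is NOT two-way `(R, ε)`-matched to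
the template `P` (no linear isometry `A` such that every `p ∈ P.points` with `‖p‖ ≤ R` has a
point of `Q` within `ε` of `q₀ + A p`, and every point of `Q` within `R` of `q₀` is within `ε`
of some `q₀ + A p`, `p ∈ P.points`), then in any finite configuration `x : Fin N → ℝ¹` drawn
from `Q.points` every particle `x i` that is congruent to `q₀` modulo `Q.lattice` and `R`-deep
(every point of `Q` within `R` of `x i` is some `x j`) is bad for the finite matching predicate.

Proof: pure logic plus translation invariance of `dist`.  If the finite predicate held at `i`
with isometry `A`, put `g := q₀ − x i ∈ Q.lattice`; translating witnesses by `g`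
(`PeriodicConfiguration.add_mem_points`, `dist_add_right`, `dist_sub_right`) and using
deepness to convert points of `Q` near `x i` into particles `x j` shows that the site predicate
holds at `q₀` with the same `A` — a contradiction.  All `[folklore]`; no named facts are used.
-/

noncomputable section

namespace Summit.AtomisticToContinuum.Crystallization.Theorems.ThreeConeCertificateExactCertificate.Transfer1D

open Literature.MathematicalPhysics.StatisticalMechanics MeasureTheory Set Filter Topology
open scoped BigOperators

/-- STUB W2 `stub_badOfBadSite1D` — LOCALITY AND LATTICE COVARIANCE OF THE MATCHING: if a site
`q₀` of `Q` is NOT two-way `(R, ε)`-matched to the template `P`, then in any finite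
configuration `x` drawn from `Q.points` every particle congruent to `q₀` modulo `Q.lattice`
whose `R`-environment in `Q` consists of particles of `x` is bad (for the finite matching
predicate of `SlackRigidity`).  Translate by the period `g = q₀ − x i` and use deepness.
[folklore] -/
theorem stub_badOfBadSite1D : ∀ (P Q : PeriodicConfiguration 1) (R ε : ℝ) (N : ℕ)
    (x : Fin N → EuclideanSpace ℝ (Fin 1)),
    (∀ i : Fin N, x i ∈ Q.points) →
    ∀ q₀ : EuclideanSpace ℝ (Fin 1), q₀ ∈ Q.points →
    (¬ ∃ A : EuclideanSpace ℝ (Fin 1) →ₗᵢ[ℝ] EuclideanSpace ℝ (Fin 1),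
        (∀ p ∈ P.points, ‖p‖ ≤ R → ∃ z ∈ Q.points, dist z (q₀ + A p) ≤ ε) ∧
        (∀ z ∈ Q.points, dist z q₀ ≤ R → ∃ p ∈ P.points, dist z (q₀ + A p) ≤ ε)) →
    ∀ i : Fin N, (x i - q₀ ∈ Q.lattice ∧ ∀ z ∈ Q.points, dist z (x i) ≤ R → ∃ j : Fin N, x j = z) →
    ¬ ∃ A : EuclideanSpace ℝ (Fin 1) →ₗᵢ[ℝ] EuclideanSpace ℝ (Fin 1),
          (∀ p ∈ P.points, ‖p‖ ≤ R → ∃ j : Fin N, dist (x j) (x i + A p) ≤ ε) ∧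
          (∀ j : Fin N, dist (x j) (x i) ≤ R → ∃ p ∈ P.points, dist (x j) (x i + A p) ≤ ε) := by
  intro P Q R ε N x hx q₀ _hq₀ hbad i hi hfin
  obtain ⟨hlat, hdeep⟩ := hi
  obtain ⟨A, h1, h2⟩ := hfin
  apply hbad
  -- the period `g := q₀ - x i`
  have hg : q₀ - x i ∈ Q.lattice := by
    have h := Q.lattice.neg_mem hlat
    rwa [neg_sub] at h
  refine ⟨A, ?_, ?_⟩
  · -- clause 1: template points near the origin are matched by points of `Q` around `q₀`
    intro p hp hpR
    obtain ⟨j, hj⟩ := h1 p hp hpR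
    refine ⟨x j + (q₀ - x i), Q.add_mem_points (hx j) hg, ?_⟩
    calc dist (x j + (q₀ - x i)) (q₀ + A p)
        = dist (x j + (q₀ - x i)) (x i + A p + (q₀ - x i)) := by
          congr 1
          abel
      _ = dist (x j) (x i + A p) := dist_add_right _ _ _
      _ ≤ ε := hj
  · -- clause 2: points of `Q` around `q₀` are matched by template points (deepness at `x i`)
    intro z hz hzR
    have hz' : z - (q₀ - x i) ∈ Q.points := by
      have h := Q.add_mem_points hz (Q.lattice.neg_mem hg)
      rwa [← sub_eq_add_neg] at h
    have hdist : dist (z - (q₀ - x i)) (x i) ≤ R := by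
      calc dist (z - (q₀ - x i)) (x i)
          = dist (z - (q₀ - x i)) (q₀ - (q₀ - x i)) := by
            congr 1
            abel
        _ = dist z q₀ := dist_sub_right _ _ _
        _ ≤ R := hzR
    obtain ⟨j, hj⟩ := hdeep _ hz' hdist
    obtain ⟨p, hp, hpj⟩ := h2 j (by rw [hj]; exact hdist)
    refine ⟨p, hp, ?_⟩
    calc dist z (q₀ + A p)
        = dist (z - (q₀ - x i)) (q₀ + A p - (q₀ - x i)) := (dist_sub_right _ _ _).symm
      _ = dist (x j) (x i + A p) := by
          rw [hj]
          congr 1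
          abel
      _ ≤ ε := hpj

end Summit.AtomisticToContinuum.Crystallization.Theorems.ThreeConeCertificateExactCertificate.Transfer1D
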